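import Summits.QuantumFields.BalabanUV.T4Continuum.Support.SubstrateTransporterSpeciesLev
import Summits.QuantumFields.BalabanUV.T4Continuum.Support.SubstrateProbesChart

/-!
# SUBSTRATE — JUNCTION AT LEVEL LETTERS: the single-cube probes on the tagged chart sort (`cubeProbesC`, p221928 ∕ p222415) × the
# level-lettered chart species (`covAtTLev`, `SubstrateTransporterSpeciesLev`) — NE4 L3's `Probes.Analytic ρ` with ONE EXPLICIT radius
# `ρ⋆ = min_k holoRadius_k` for all steps `k` and all probes `p`, at the PRINTED letters (typer RULING (η1), S-LEV, pencilled item)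

Cell `pub-balaban`, SUBSTRATE cell, seat `b2b-balaban-substrate-p1` (gen 3).  Summits-side under the LEAN PLACEMENT RULE.  A separate junction
module (as p222415) so that the species modules' cones stay free of the read-out Literature chain.  HONEST FRAMING: rung (B)+1 of the
FINITE-VOLUME T⁴ programme — NOT infinite volume, NOT a mass gap, NOT Clay; spine PROVED 0∕9; NE4 ∕ NE9 NOT proved.  BOOKKEEPING ONLY: composition
of `SubstrateProbesOfRecord` §6 (`tagSlice_mem_analytic_cubeProbesC_iff`, `chartAnalytic_cubeProbesC_iff`) with `SubstrateTransporterSpeciesLev` §§2–4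
(`analyticOnNhd_covAtTLev_expChart`, `analyticOnNhd_covAtTLev_printed_on_ball`, `rhoStarOfRecord`); which term family NE4's functional of record
reads and which background per run are the NE4 owner's (t4-ne4-p1); nothing printed is asserted ([Balaban1987RG1] (1.17)–(1.22), (4.4) KIND only).
HONEST DEPENDENCY (cell line, verbatim): continuum YM on T⁴ ⇐ BetaPertH ∧ nine spine estimates (0/9 proved); BetaPertH ⇐ (D1) ∧ (D4) ∧
CAP+tail; G-an2-4 gates asym, D1 and NE2/3/4.

WHAT.  §1 generic: `tagSlice_mem_analytic_cubeProbesC_of_ball` (analytic on `ball 0 ρ` at every cube ⇒ in `Probes.Analytic ρ` AT THAT `ρ`),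
`tagSlice_mem_analytic_cubeProbesC_of_regularSetLev` (openness form at general letters).  §2 the level-lettered species-entry families
`covEntryFamilyLev` (one entry of `covAtTLev` per probe; letter tables `kOf ∕ tOf ∕ bOf ∕ b′Of`), `covEntryFamilyLev_const` (= p222415's
`covEntryFamily` at constant letters, `rfl`), `analyticOnNhd_covEntryFamilyLev` (on `regularSetLev`), `covEntryFamilyLev_mem_analytic` (openness,
general letters), **`covEntryFamilyLev_mem_analytic_rhoStar`** (printed letters, unitary levelwise-coercive reference tower: in `Probes.Analytic ρ⋆`,
`ρ⋆` EXPLICIT), **`covEntryFamilyLev_mem_analytic_rhoStarOfRecord`** (chart centred at the tower data OF RECORD of a levelwise-regular `U`: the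
binders are the small-field letters `α`, `τ`, `0 < a′`, `0 < gammaV` only), `chartAnalytic_covEntryFamilyLev`.
-/

noncomputable section

open scoped BigOperators Matrix Matrix.Norms.L2Operator

namespace Summit.QuantumFields.BalabanUV.T4Continuum.SubstrateProbesChartLev

open Literature.MathematicalPhysics.QuantumFieldTheory.Balaban1983to89
open Literature.MathematicalPhysics.QuantumFieldTheory.Balaban1983to89.B5Prop11Plancherel (Tor fine)
open Literature.MathematicalPhysics.QuantumFieldTheory.Balaban1983to89.B5G183RateUnitTower (lev)
open Literature.MathematicalPhysics.QuantumFieldTheory.Balaban1983to89.T4BetaReadOutLipschitz (Probes tagSlice)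
open Summit.QuantumFields.BalabanUV.T4Continuum.CovariantBlockAveraging (ContourSystem transport)
open Summit.QuantumFields.BalabanUV.T4Continuum.CoerciveInverseTower (Coercive)
open Summit.QuantumFields.BalabanUV.T4Continuum.CovariantVectorCoercive (vecOp gammaV)
open Summit.QuantumFields.BalabanUV.T4Continuum.B13Carriers (TwoRuns)
open Summit.QuantumFields.BalabanUV.T4Continuum.SubstrateBackgroundTransporters (unitMod)
open Summit.QuantumFields.BalabanUV.T4Continuum.SubstrateTransporterSpecies (TowerData covAtT towerDataOf)
open Summit.QuantumFields.BalabanUV.T4Continuum.SubstrateTransporterSpeciesHolo (expChartT expChartInvT)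
open Summit.QuantumFields.BalabanUV.T4Continuum.SubstrateTransporterSpeciesLev
open Summit.QuantumFields.BalabanUV.T4Continuum.SubstrateProbesOfRecord
open Summit.QuantumFields.BalabanUV.T4Continuum.SubstrateProbesChart (covEntryFamily)

variable {G : Type} [GaugeGroup G] (R : TwoRuns G) (P : Params) {o : Type} [Fintype o] [DecidableEq o]
variable {dirA dirB : ℕ → R.carriers.Dom → TowerData P o} {wt : ℕ → R.carriers.Dom → ℝ}
variable (cL : ℕ → ℂ) (aL : ℕ → ℝ) (Γ : (k : ℕ) → ContourSystem P.d (lev P.L k) (unitMod P)) (R₀ : TowerData P o)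

/-! ## §1 Generic junctions: analyticity on a ball ∕ on the level-lettered regular set ⇒ the probe class -/

/-- [folklore] **`Probes.Analytic ρ` AT A GIVEN RADIUS**: a complex term family analytic (per single cube) on the chart ball `ball 0 ρ` lies in
`(cubeProbesC …).Analytic ρ` — at THAT `ρ` (no existential). -/
theorem tagSlice_mem_analytic_cubeProbesC_of_ball (E : R.carriers.Dom → TowerData P o → ℂ) {ρ : ℝ}
    (hE : ∀ p, AnalyticOnNhd ℂ (E p) (Metric.ball (0 : TowerData P o) ρ)) : tagSlice E ∈ (cubeProbesC R dirA dirB wt).Analytic ρ :=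
  (tagSlice_mem_analytic_cubeProbesC_iff E ρ).2 fun _ p _ => hE p

/-- [folklore] **`Probes.Analytic` FROM THE LEVEL-LETTERED REGULAR SET** (openness form, general letters; `ρ` NOT computed): a complex term family
analytic on `regularSetLev P cL aL Γ R⁰`, with a centre regular at every level, lies in `(cubeProbesC …).Analytic ρ` for some `ρ > 0`. -/
theorem tagSlice_mem_analytic_cubeProbesC_of_regularSetLev (E : R.carriers.Dom → TowerData P o → ℂ)
    (hE : ∀ p, AnalyticOnNhd ℂ (E p) (regularSetLev P cL aL Γ R₀)) (h0 : (0 : TowerData P o) ∈ regularSetLev P cL aL Γ R₀) :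
    ∃ ρ > 0, tagSlice E ∈ (cubeProbesC R dirA dirB wt).Analytic ρ := by
  obtain ⟨ρ, hρ, hsub⟩ := Metric.isOpen_iff.1 (isOpen_regularSetLev P cL aL Γ R₀) 0 h0
  exact ⟨ρ, hρ, tagSlice_mem_analytic_cubeProbesC_of_ball R P E fun p => (hE p).mono hsub⟩

/-! ## §2 The level-lettered species-entry families -/

variable (s : ℕ → ℂ) {T : Type} (kOf : R.carriers.Dom → ℕ) (tOf : R.carriers.Dom → T)
  (bOf b'Of : R.carriers.Dom → (Tor (unitMod P) × Fin P.d) × o)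

/-- [folklore] DATA: the LEVEL-LETTERED SPECIES-ENTRY term family — at the single cube `p`, the entry `(kOf p, tOf p, bOf p, b′Of p)` of `covAtTLev`
read along the tower chart at `R⁰` (letter tables displayed; a MODEL family for non-vacuity, not NE4's functional of record). -/
def covEntryFamilyLev : R.carriers.Dom → TowerData P o → ℂ :=
  fun p A => covAtTLev P cL aL Γ s (expChartT P R₀ A) (expChartInvT P R₀ A) (kOf p) (tOf p) (bOf p) (b'Of p)

/-- [folklore] COEXISTENCE: at constant letters the level-lettered entry family IS p222415's `covEntryFamily` (`rfl`). -/
theorem covEntryFamilyLev_const (c : ℂ) (a : ℝ) :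
    covEntryFamilyLev R P (fun _ => c) (fun _ => a) Γ R₀ s kOf tOf bOf b'Of = covEntryFamily R P c a Γ R₀ s kOf tOf bOf b'Of := rfl

/-- [folklore] Every level-lettered species-entry family is analytic on `regularSetLev` (`analyticOnNhd_covAtTLev_expChart` BY NAME). -/
theorem analyticOnNhd_covEntryFamilyLev (p : R.carriers.Dom) :
    AnalyticOnNhd ℂ (covEntryFamilyLev R P cL aL Γ R₀ s kOf tOf bOf b'Of p) (regularSetLev P cL aL Γ R₀) :=
  analyticOnNhd_covAtTLev_expChart P cL aL Γ s R₀ (kOf p) (tOf p) (bOf p) (b'Of p)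

/-- [folklore] Openness form at general letters: with a centre regular at every level at the letters `(cL k, aL k)` (DISPLAYED), the tagged
slice of every level-lettered species-entry family lies in `(cubeProbesC …).Analytic ρ` for some `ρ > 0`. -/
theorem covEntryFamilyLev_mem_analytic (h0 : (0 : TowerData P o) ∈ regularSetLev P cL aL Γ R₀) :
    ∃ ρ > 0, tagSlice (covEntryFamilyLev R P cL aL Γ R₀ s kOf tOf bOf b'Of) ∈ (cubeProbesC R dirA dirB wt).Analytic ρ :=
  tagSlice_mem_analytic_cubeProbesC_of_regularSetLev R P cL aL Γ R₀ _ (analyticOnNhd_covEntryFamilyLev R P cL aL Γ R₀ s kOf tOf bOf b'Of) h0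

variable {R₀} in
/-- [folklore] **NE4 L3's `hAan` WITH ONE EXPLICIT RADIUS**: at the PRINTED letters `(L^k, a′·L^{kd})`, for a unitary, levelwise
`γ_k`-coercive reference tower `R⁰`, the tagged slice of every level-lettered species-entry family lies in `(cubeProbesC …).Analytic ρ⋆` with
`ρ⋆ = rhoStar … = min_k holoRadius_k` — ONE radius for all steps and probes, no existential, no openness argument. -/
theorem covEntryFamilyLev_mem_analytic_rhoStar (hR₀ : ∀ (k : Fin (P.K + 1)) ν i, R₀ k ν i ∈ Matrix.unitaryGroup o ℂ) {a' : ℝ}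
    {γ : Fin (P.K + 1) → ℝ} (hco : ∀ k : Fin (P.K + 1), Coercive (γ k) (vecOp (lev P.L k) (unitMod P) a' (Γ k) (R₀ k))) (hγ : ∀ k, 0 < γ k) :
    tagSlice (covEntryFamilyLev R P (cPr P) (aPr P a') Γ R₀ s kOf tOf bOf b'Of) ∈ (cubeProbesC R dirA dirB wt).Analytic (rhoStar P Γ hR₀ hco hγ) :=
  tagSlice_mem_analytic_cubeProbesC_of_ball R P _ fun p =>
    analyticOnNhd_covAtTLev_printed_on_ball P Γ hR₀ hco hγ s (kOf p) (tOf p) (bOf p) (b'Of p)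

section Record

variable {G' : Type*} [GaugeGroup G'] (ι : G' →* Matrix o o ℂ) (av : ∀ j, Averaging P j G') {a' α τ : ℝ}

/-- [folklore] **… AT THE TOWER DATA OF RECORD** of a levelwise-regular configuration `U` (unitary `ι` with `‖ι g − 1‖ = dist1 g`; the small-field
letters `α`, `τ` at every level, `0 < a′`, `0 < gammaV` — J-3a BY NAME through `rhoStarOfRecord`): in `(cubeProbesC …).Analytic ρ⋆` at the chart
centred at `towerDataOf P ι av U`, radius `rhoStarOfRecord`. -/
theorem covEntryFamilyLev_mem_analytic_rhoStarOfRecord (hι : ∀ g, ι g ∈ Matrix.unitaryGroup o ℂ) (hdist : ∀ g : G', ‖ι g - 1‖ = dist1 g)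
    (U : GaugeField P 0 G') (ha' : 0 < a') (hα : 0 ≤ α) (hτ : 0 ≤ τ)
    (hU : ∀ (k : Fin (P.K + 1)) (b : PBond P (P.K - k)), ((lev P.L k : ℕ) : ℝ) * dist1 (Averaging.iter av (P.K - k) U b) ≤ α)
    (hT : ∀ (k : Fin (P.K + 1)) y jj μ (t : Fin (lev P.L k)),
      ‖transport (fine (lev P.L k) (unitMod P)) (towerDataOf P ι av U k) μ (Γ k y jj μ t) - 1‖ ≤ τ)
    (hγV : 0 < gammaV (Fintype.card o) P.d a' α τ) :
    tagSlice (covEntryFamilyLev R P (cPr P) (aPr P a') Γ (towerDataOf P ι av U) s kOf tOf bOf b'Of)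
      ∈ (cubeProbesC R dirA dirB wt).Analytic (rhoStarOfRecord P Γ ι av hι hdist U ha' hα hτ hU hT hγV) :=
  tagSlice_mem_analytic_cubeProbesC_of_ball R P _ fun p =>
    analyticOnNhd_covAtTLev_printed_towerDataOf P Γ s ι av hι hdist U ha' hα hτ hU hT hγV (kOf p) (tOf p) (bOf p) (b'Of p)

end Record

/-- [folklore] The displayed face `ChartAnalytic` for (coupling-indexed) level-lettered species-entry families on `regularSetLev` — no centre
hypothesis needed. -/
theorem chartAnalytic_covEntryFamilyLev (sg : (ℕ → ℝ) → ℕ → ℂ) (g : ℕ → ℝ) :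
    ChartAnalytic (cubeProbesC R dirA dirB wt) (fun g => tagSlice (covEntryFamilyLev R P cL aL Γ R₀ (sg g) kOf tOf bOf b'Of)) g
      (fun _ _ => regularSetLev P cL aL Γ R₀) :=
  (chartAnalytic_cubeProbesC_iff (fun g => covEntryFamilyLev R P cL aL Γ R₀ (sg g) kOf tOf bOf b'Of) g _).2 fun _ p _ =>
    (analyticOnNhd_covEntryFamilyLev R P cL aL Γ R₀ (sg g) kOf tOf bOf b'Of p).differentiableOn

end Summit.QuantumFields.BalabanUV.T4Continuum.SubstrateProbesChartLev

end
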